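import Summits.HodgeConjecture.FermatCycles.ConditionQPrimeToSix
import Summits.HodgeConjecture.HodgeConjecture.Theorems.PadicSemiregularLiftHodgeFermatVarietiesTwinAssembly
import Summits.HodgeConjecture.HodgeConjecture.Theorems.PadicSemiregularLiftHodgeFermatVarietiesCoprimeSixPayoff
import HarnessLib

/-!
# Fermat fourfolds of degree prime to `6`: `(Q⁴ₘ) ⟺ (P⁴ₘ) ⟺ ¬(5 ∣ m ∧ m > 5)` (companion of `ConditionQPrimeToSix`)

HONEST FRAMING: explicit algebraic cycles for specific Hodge classes on Fermat/Delsarte varieties;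
residual open instances listed; no claim on general Hodge.

Topic path `Summits/HodgeConjecture/FermatCycles/` of cell `pub-hfermat`; split off `ConditionQPrimeToSix.lean` for size. That file proves, with no
hypothesis beyond `gcd(m, 6) = 1`, that Shioda's `M'ₘ` is generated by the pairs and that `(Q⁴ₘ)` fails when `5 ∣ m`, `m > 5`. THIS FILE adds the
converse for fourfolds: if `¬(5 ∣ m ∧ m > 5)` (still `gcd(m, 6) = 1`) then EVERY Hodge sextuple is symmetric (`isSymmetric_of_card_six_of_not_five`:
by the tree's progression theorem `PairedNull.stub_exists_fibre_of_not_paired_le_six` [Aoki1983, Thm A′] a non-symmetric sextuple needs `p₁ = 5`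
— impossible, `m = 5` being excluded by `5A ≠ 0` — or is filled by six points of a `7`-progression, whose sum `6A + c·(m/7)` is non-zero), hence
`Q + (−Q)` (tree: `CoprimeSix.exists_pairs_of_count_symm`), hence decomposable and an element of `M'ₘ`. So (`fourfold_iff_of_coprime_six`):

**for `m` prime to `6`: `(Q⁴ₘ) ⟺ ¬(5 ∣ m ∧ m > 5) ⟺ (P⁴ₘ)`** — Shioda's method for `X⁴ₘ`, in its original form `(P⁴ₘ)` [Shioda1979HodgeFermat, Thm IV]
or its stable form `(Q⁴ₘ)` [loc. cit. §4], works exactly off the levels `m = 25, 35, 55, 65, 85, 95, 115, …`; consistent with the cell's table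
(`P4-TABLE.md`: `(P⁴)` true at `49, 77, 91`, `(Q⁴)` false at the six levels `≤ 100` divisible by `5`) and with [Aoki1983, Thm A] (`𝔅⁴ₘ = 𝔇⁴ₘ` when
every prime factor of `m` exceeds `6`). No hypothesis, no fact, no `sorry`.

References: [Shioda1979HodgeFermat] T. Shioda, Math. Ann. 245 (1979) 175–184, §4; [Shioda1981FermatType] T. Shioda, Math. Ann. 258 (1981), Appendix;
[Aoki1983] N. Aoki, Math. Ann. 266 (1983) 23–54, Thm A, Thm A′ (§7); [Aoki1987] N. Aoki, J. Math. Soc. Japan 39 (1987) §1.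
-/

namespace Summit.HodgeConjecture.FermatCycles.ConditionQPrimeToSixFourfold

open Multiset
open Literature.AlgebraicGeometry.HodgeTheory Literature.AlgebraicGeometry.HodgeTheory.FermatCharacter
open Literature.AlgebraicGeometry.Shioda1979 Literature.AlgebraicGeometry.Shioda1981
open Summit.HodgeConjecture.FermatCycles.ConditionQSymmetric Summit.HodgeConjecture.FermatCycles.ConditionQCoprimeSix
open Summit.HodgeConjecture.FermatCycles.ConditionQPrimeToSix
open Summit.HodgeConjecture.HodgeConjecture.Theorems.CancelByAnyClaimLattice

variable {m : ℕ}

/-! ### Fermat fourfolds of degree prime to `6`: `(Q⁴ₘ) ⟺ (P⁴ₘ) ⟺ ¬(5 ∣ m, m > 5)` -/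

/-- A sum of pairs of non-zero residues lies in `M'ₘ`. [cite: Shioda1979HodgeFermat, §4 p. 183 (Mₘ(1) ⊂ M'ₘ)] -/
theorem pairs_mem_mPrime [NeZero m] (Q : Multiset (ZMod m)) (hQ0 : ∀ a ∈ Q, a ≠ 0) :
    Q + Q.map (fun x ↦ -x) ∈ MPrime m := by
  induction Q using Multiset.induction with
  | empty => simp
  | cons a Q ih =>
    have ha : a ≠ 0 := hQ0 a (Multiset.mem_cons_self a Q)
    have e : (a ::ₘ Q) + (a ::ₘ Q).map (fun x ↦ -x) = ({a, -a} : Multiset (ZMod m)) + (Q + Q.map (fun x ↦ -x)) := by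
      simp only [Multiset.map_cons, Multiset.cons_add, Multiset.add_cons, insert_eq_cons, singleton_add]
      rw [Multiset.cons_swap]
    rw [e]
    exact AddSubmonoid.add_mem _ (mem_mPrime_of_mem ⟨IsHodgeMultiset.pair ha, Or.inl (by simp)⟩)
      (ih fun b hb ↦ hQ0 b (Multiset.mem_cons_of_mem hb))

/-- **At a level prime to `6` with `¬(5 ∣ m ∧ m > 5)`, every Hodge sextuple is symmetric**: by the tree's progression theorem a non-symmetric one
would contain four points of a `5`-progression (needs `5 ∣ m`, and `m = 5` is excluded by `5A ≠ 0`) or six points of a `7`-progression filling it,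
whose sum `6A + c(m/7)` is non-zero (`7·` it is `42A ≠ 0`). [cite: Aoki1983, Thm A′ (§7)] -/
theorem isSymmetric_of_card_six_of_not_five [NeZero m] (h6 : Nat.Coprime m 6) (h5 : ¬ (5 ∣ m ∧ 5 < m))
    {s : Multiset (ZMod m)} (hs : IsHodgeMultiset s) (h6c : card s = 6) : IsSymmetric s := by
  by_contra hns
  obtain ⟨x, hx⟩ : ∃ x, count x s ≠ count (-x) s := by
    by_contra hall
    push Not at hall
    exact hns hall
  obtain ⟨p₁, hp57, hp₁m, A, hA, j₀, hj₀, hfib⟩ :=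
    PairedNull.stub_exists_fibre_of_not_paired_le_six m h6 s hs (by rw [h6c]) ⟨x, hx⟩
  rcases hp57 with rfl | rfl
  · -- `p₁ = 5`: then `m = 5`, where `5A = 0`
    have hm5 : m = 5 := by
      have hpos := Nat.pos_of_ne_zero (NeZero.ne m)
      have h5le := Nat.le_of_dvd hpos hp₁m
      have hle : m ≤ 5 := by
        by_contra h
        exact h5 ⟨hp₁m, by omega⟩
      omega
    apply hA
    have h50 : ((5 : ℕ) : ZMod m) = 0 := (ZMod.natCast_eq_zero_iff 5 m).2 (by rw [hm5])
    rw [h50, zero_mul]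
  · -- `p₁ = 7`: `s` is the six progression points; their sum is `6A + c·(m/7) ≠ 0`
    set S : Finset ℕ := (Finset.range 7).erase j₀ with hS_def
    have hSlt : ∀ j ∈ S, j < 7 := fun j hj ↦ Finset.mem_range.mp (Finset.mem_of_mem_erase hj)
    have hSmem : ∀ j ∈ S, A + (j : ZMod m) * ((m / 7 : ℕ) : ZMod m) ∈ s := fun j hj ↦
      hfib j (hSlt j hj) (Finset.ne_of_mem_erase hj)
    have hle := progression_le hp₁m S hSlt s hSmem
    have hScard : S.card = 6 := by
      rw [hS_def, Finset.card_erase_of_mem (Finset.mem_range.mpr hj₀), Finset.card_range]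
    have heq := Multiset.eq_of_le_of_card_le hle (by rw [Multiset.card_map, Finset.card_val, hScard, h6c])
    have hsum := hs.1.2
    rw [← heq, Multiset.sum_map_add, Multiset.sum_map_mul_right, Multiset.map_const', Multiset.sum_replicate, Finset.card_val,
      hScard] at hsum
    have h7d : ((7 : ℕ) : ZMod m) * ((m / 7 : ℕ) : ZMod m) = 0 := by
      rw [← Nat.cast_mul, Nat.mul_div_cancel' hp₁m, ZMod.natCast_self]
    have h6u : IsUnit (6 : ZMod m) := by
      have hu := (ZMod.unitOfCoprime 6 h6.symm).isUnit
      rwa [ZMod.coe_unitOfCoprime, Nat.cast_ofNat] at hu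
    apply hA
    have e : (6 : ZMod m) * (((7 : ℕ) : ZMod m) * A) = 0 := by
      rw [nsmul_eq_mul, Nat.cast_ofNat] at hsum
      push_cast at h7d ⊢
      linear_combination (7 : ZMod m) * hsum - (Multiset.map (fun j : ℕ ↦ (j : ZMod m)) S.val).sum * h7d
    exact_mod_cast h6u.mul_right_eq_zero.mp e

/-- **Fermat fourfolds of degree prime to `6`: Shioda's original condition `(P⁴ₘ)` and its stable form `(Q⁴ₘ)` hold exactly when
`¬(5 ∣ m ∧ m > 5)`**, i.e. they fail precisely at `m = 25, 35, 55, 65, 85, 95, 115, …` and hold at every other `m` prime to `6` (e.g. `49, 77, 91`):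
if `¬(5 ∣ m, m > 5)` every Hodge sextuple is symmetric, hence `Q + (−Q)`, hence decomposable and in `M'ₘ`; otherwise Aoki's `σ_{5,1}` refutes `(Q⁴ₘ)`,
hence `(P⁴ₘ)`. [cite: Shioda1979HodgeFermat, §4 pp. 183–184 ((P⁴ₘ) ⇒ (Q⁴ₘ) ⇒ HC(X⁴ₘ))] [cite: Aoki1983, Thm A (𝔅ⁿₘ = 𝔇ⁿₘ iff all primes > n + 2) and Thm A′]
[cite: Shioda1981FermatType, Appendix (m = 25)] -/
theorem fourfold_iff_of_coprime_six [NeZero m] (h6 : Nat.Coprime m 6) :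
    (ConditionQ m 4 ↔ ¬ (5 ∣ m ∧ 5 < m)) ∧ (ShiodaConditionUpTo m 4 ↔ ¬ (5 ∣ m ∧ 5 < m)) := by
  -- `¬(5 ∣ m ∧ m > 5)` ⇒ `(P⁴ₘ)`
  have hP : ¬ (5 ∣ m ∧ 5 < m) → ShiodaConditionUpTo m 4 := by
    intro h5 s hs h6le hle6
    have h6c : card s = 6 := by omega
    have hsym := isSymmetric_of_card_six_of_not_five h6 h5 hs h6c
    obtain ⟨Q, hQ0, rfl⟩ := CoprimeSix.exists_pairs_of_count_symm h6 _ s rfl hs hsym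
    -- `Q = a ::ₘ Q'` with `Q' ≠ 0`; `s = {a, -a} + (Q' + (-Q'))`
    have hQcard : card Q = 3 := by
      rw [Multiset.card_add, Multiset.card_map] at h6c
      omega
    obtain ⟨a, Q', rfl⟩ : ∃ a Q', Q = a ::ₘ Q' := by
      induction Q using Multiset.induction with
      | empty => simp at hQcard
      | cons a Q' _ => exact ⟨a, Q', rfl⟩
    have ha : a ≠ 0 := hQ0 a (Multiset.mem_cons_self a Q')
    have hQ'0 : ∀ b ∈ Q', b ≠ 0 := fun b hb ↦ hQ0 b (Multiset.mem_cons_of_mem hb)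
    have hQ'card : card Q' = 2 := by rw [Multiset.card_cons] at hQcard; omega
    left
    refine ⟨{a, -a}, Q' + Q'.map (fun x ↦ -x), by simp, ?_, IsHodgeMultiset.pair ha,
      isHodgeMultiset_of_mem_mPrime (pairs_mem_mPrime Q' hQ'0), ?_⟩
    · intro h
      have := congrArg card h
      rw [Multiset.card_add, Multiset.card_map, hQ'card] at this
      simp at this
    · simp only [Multiset.map_cons, Multiset.cons_add, Multiset.add_cons, insert_eq_cons, singleton_add]
      rw [Multiset.cons_swap]
  -- `5 ∣ m ∧ m > 5` ⇒ `¬(Q⁴ₘ)` (`m ≥ 25 ≥ 15` as `gcd(m, 6) = 1`)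
  have hQ : 5 ∣ m ∧ 5 < m → ¬ ConditionQ m 4 := by
    rintro ⟨h5, hlt⟩
    refine not_conditionQ_four_of_coprime_six h6 h5 ?_
    obtain ⟨k, rfl⟩ := h5
    have hk : Nat.Coprime k 6 := Nat.Coprime.coprime_dvd_left ⟨5, by ring⟩ h6
    have hk2 : k ≠ 2 := by rintro rfl; norm_num at hk
    omega
  constructor
  · constructor
    · intro hQ4 h5; exact hQ h5 hQ4
    · intro h5; exact conditionQ_of_shiodaConditionUpTo (hP h5)
  · constructor
    · intro hP4 h5; exact hQ h5 (conditionQ_of_shiodaConditionUpTo hP4)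
    · exact hP

end Summit.HodgeConjecture.FermatCycles.ConditionQPrimeToSixFourfold
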